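import Literature.MathematicalPhysics.QuantumFieldTheory.Balaban1983to89.Node00.MultiScaleFibreChartCurvatureUniform
import Literature.MathematicalPhysics.QuantumFieldTheory.Balaban1983to89.Node00.MultiScaleFibreChartLagrangeB

/-!
# NODE 00 — ONE CHART-CURVATURE CONSTANT PER HEIGHT AT THE **BOND-DATUM** CHART `msChartB` — the print-datum ([Balaban1984PropagatorsII] (2.3)) edition of
# `Node00/MultiScaleFibreChartCurvatureUniform` §2 ★ ∕ §4 ★★★ (the two declarations N12's junction of record v14ᴸ uses with a datum-bearing statement:
# `eventually_msChart_apply_eq_chartModel`, `exists_uniform_chartCurvature_sq_bound`); its §1 (compactness), §2 model lemmas and §3 radius are datum-free and REUSED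

statement-level skeleton of published theorems with citation tags; proofs where landed; nothing here is a claim about
the Yang–Mills mass gap

Cell `pub-ymgap` (HUMAN RULINGS D-0062 ∕ D-0149), lane `pub-ymgap-dag-n12-c` g35 (R134 seat (a), N12 = [B15], s1, lane owner); `--kind proof --supports` K1⁹ `stmt-QuantumFields-27364`;
count-neutral.  THEOREMS ONLY (0 `def`, 0 `instance`, 0 `sorry`).  (E1) variant (iii-b), class (γ) of the lane's census-by-declaration v2 (bus [DAGN12C-G35], 2026-08-30).  GENERATOR twin
(HOME `lean/g35/gen/gen_CurvUB.py`, block-extracted from the parent's tree bytes, substitutions asserted): Node 00 convention — SAME namespace `…Node00`, `B`-suffixed names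
(`eventually_msChartB_apply_eq_chartModel`, `exists_uniform_chartCurvatureB_sq_bound`), `{𝐁 : DetSet} ↦ {𝔅 : BDetSet}`, `AgreeOn ↦ AgreeOnB`, `msChart ∕ constrCard ∕ constrEnum ↦ …B` (lane
`Node00/MultiScaleFibreChartB`), regularity binders from the lane's `Node00/MultiScaleFibreChartLagrangeB`; proofs VERBATIM.

HONESTY GUARD (director-ym №338 (5)).  PURELY ADDITIVE: the parent stays landed and true on its own text; nothing in it is edited; no displayed premise of any consumer is deleted or weakened.
LOCATED (inherited from the parent): the curvature constant `M₂` is per torus and per height (finite-dimensionality + compactness), NOT print's volume-uniform `O(1)`.  Nothing of [15]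
asserted; K0⁷ ∕ K1⁹ NOT closed; N07 ∕ N12 NOT discharged; one finite 𝕋⁴ programme at fixed ε — NOT continuum ∕ ℝ⁴ ∕ OS ∕ mass gap ∕ Clay.

References: [Balaban1989LargeFieldII] (1.12) p.359; [15] = [Balaban1985Variational] Sect. C (44)–(48) p.285, (81)–(83) p.290; [Balaban1987RG1] (0.4) p.253, (0.21) p.256;
[III] = [Balaban1988Convergent] (2.10)–(2.12) p.256; [II] = [Balaban1984PropagatorsII] (2.3) p.224.
-/

noncomputable section

namespace Literature.MathematicalPhysics.QuantumFieldTheory.Balaban1983to89.Node00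

open Filter Topology Metric
open T4Continuum (T4Family)
open B15DeterminingSets B15DeterminingSetsB
open T4AdjointCovarianceUnitary (lieSU)
open MatrixLog (mlog analyticAt_mlog)
open B15AveragingHolomorphic (iterMh loopMh iterMh_coeField_eq_iterM coeField_iter_eq_iterMh)
open B15AveragingAnalytic (contDiffAt_iterMh_of_polydisc)
open B15Prop1DatumCoordinates (eventually_polydisc eventually_smallBelow)
open BlockAveraging (blockAvg Idx)
open ExpMeanLog (expMeanLogSU)
open scoped Matrix.Norms.L2Operator BigOperators

section ModelB

variable {F : T4Family} {N : ℕ} [NeZero N] {K : ℕ}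

/-- ★ **ON THE FIBRE AND UNDER THE GUARD, THE CHART OF RECORD IS THE MODEL AT `V := ↑U₀`, NEAR `X = 0`**: for `U₀` guarded below `k` with `W = M˙(U₀)` on `𝐁`, the component of
`msChartB F N K k 𝔅 W U₀` at the constrained bond `i ↔ (j,c)` equals `π(log((M_h^j ↑U₀ c)* · M_h^j(↑U₀ ⊙ e^X)(c)))` for `X` near `0` (the averages of `U₀·e^X` stay guarded, `relAvg_expChart_eq_of_smallBelow`, the
smooth and holomorphic iterates agree under the guard). [cite: Balaban1987RG1, (0.4) p.253, (0.21) p.256; Balaban1988Convergent, (2.10)–(2.12) p.256] -/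
theorem eventually_msChartB_apply_eq_chartModel {k : ℕ} {𝔅 : BDetSet (F.P K)} {W : MSField (F.P K) (SU N)} {U : GaugeField (F.P K) 0 (SU N)}
    (hU : AgreeOnB 𝔅 (avgFamily (avOfRecord F N K) U) W) (hsb : SmallBelow (avOfRecord F N K) k U) (i : Fin (constrCardB 𝔅 k)) :
    (fun X => msChartB F N K k 𝔅 W U X i) =ᶠ[𝓝 (0 : PBond (F.P K) 0 → lieSU (Fin N))] fun X =>
      suProj N (mlog (star (iterMh (((constrEnumB 𝔅 k).symm i).1 : ℕ) (coeField U) ((constrEnumB 𝔅 k).symm i).2.1) *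
        iterMh (((constrEnumB 𝔅 k).symm i).1 : ℕ) (fun b => coeField U b * NormedSpace.exp ((X b : lieSU (Fin N)) : Matrix (Fin N) (Fin N) ℂ))
          ((constrEnumB 𝔅 k).symm i).2.1)) := by
  set s := (constrEnumB 𝔅 k).symm i with hs
  have hj : (s.1 : ℕ) ≤ k := Nat.lt_succ_iff.1 s.1.2
  filter_upwards [eventually_smallBelow_expChart (P := F.P K) hsb] with X hX
  rw [msChartB_apply, ← hs, relAvg_expChart_eq_of_smallBelow hX hj, ← hU s.1 s.2.1 s.2.2]
  have hW : ((avgFamily (avOfRecord F N K) U s.1 s.2.1 : SU N) : Matrix (Fin N) (Fin N) ℂ) = iterMh (s.1 : ℕ) (coeField U) s.2.1 := by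
    have h := B15AveragingHolomorphic.coeField_avgFamily_eq_iterMh (hsb.mono hj)
    exact congrFun h s.2.1
  have hX' : SmallBelow (fun j => blockAvg (P := F.P K) (j := j) expMeanLogSU) (s.1 : ℕ) (expChart U X) := hX.mono hj
  rw [hW, ← iterMh_coeField_eq_iterM (s.1 : ℕ) hX', coeField_expChart_eq_mulExp]

end ModelB

section UniformB

variable {F : T4Family} {N : ℕ} [NeZero N] {K : ℕ}

/-- ★★★ **ONE CHART-CURVATURE CONSTANT PER HEIGHT**: there are `M₂ ≥ 0` and `ρ″ > 0` such that (a) every background `U₀` with `‖↑U₀ − ↑1‖ ≤ ρ″` is guarded below `k` (so the chart is `C^∞`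
at `0`, p610492's regularity binders apply), and (b) for EVERY BOND determining set `𝔅`, EVERY multi-scale datum `W`, and EVERY such `U₀` on the fibre of `W` (`M˙(U₀) = W`
on `𝐁`): `‖D²Ψ(0)(w,w)‖ ≤ M₂·‖w‖²` for `Ψ := msChartB F N K k 𝔅 W U₀` and all directions `w`.  (§1 on the compact ball `‖V − ↑1‖ ≤ ρ″` of matrix fields for the finite family of component
models, §2's identification of the chart with the model, §3's radius.)  LOCATED: `M₂` depends on the torus `F.P K` and on `k` (per height, as dag-n10-w1's `ρ′`), NOT print's volume-uniform
`O(1)`. [cite: Balaban1985Variational, Sect. C (44)–(48) p.285, (81)–(83) p.290; Balaban1989LargeFieldII, (1.12) p.359; Balaban1988Convergent, (2.10)–(2.12) p.256] -/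
theorem exists_uniform_chartCurvatureB_sq_bound (k : ℕ) :
    ∃ M₂ ρ'' : ℝ, 0 ≤ M₂ ∧ 0 < ρ'' ∧
      (∀ U₀ : GaugeField (F.P K) 0 (SU N), ‖coeField U₀ - 1‖ ≤ ρ'' → SmallBelow (avOfRecord F N K) k U₀) ∧
      ∀ (𝔅 : BDetSet (F.P K)) (W : MSField (F.P K) (SU N)) (U₀ : GaugeField (F.P K) 0 (SU N)),
        ‖coeField U₀ - 1‖ ≤ ρ'' → AgreeOnB 𝔅 (avgFamily (avOfRecord F N K) U₀) W →
        ∀ w : PBond (F.P K) 0 → lieSU (Fin N), ‖fderiv ℝ (fderiv ℝ (msChartB F N K k 𝔅 W U₀)) 0 w w‖ ≤ M₂ * ‖w‖ ^ 2 := by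
  obtain ⟨ρ'', hρ, hrad⟩ := exists_radius_chartModel (F := F) (N := N) (K := K) k
  let f : (PBond (F.P K) 0 → Matrix (Fin N) (Fin N) ℂ) → (PBond (F.P K) 0 → lieSU (Fin N)) →
      (Σ j : Fin (k + 1), PBond (F.P K) j) → lieSU (Fin N) := fun V X s =>
    suProj N (mlog (star (iterMh (s.1 : ℕ) V s.2) * iterMh (s.1 : ℕ) (fun b => V b * NormedSpace.exp ((X b : lieSU (Fin N)) : Matrix (Fin N) (Fin N) ℂ)) s.2))
  have hS : IsCompact (closedBall (1 : PBond (F.P K) 0 → Matrix (Fin N) (Fin N) ℂ) ρ'') := isCompact_closedBall _ _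
  have hf : ∀ a ∈ closedBall (1 : PBond (F.P K) 0 → Matrix (Fin N) (Fin N) ℂ) ρ'', ContDiffAt ℝ 2 (Function.uncurry f) (a, 0) := by
    intro a ha
    rw [mem_closedBall, dist_eq_norm] at ha
    obtain ⟨-, hpoly, hlog⟩ := hrad a ha
    refine contDiffAt_pi.2 fun s => ?_
    have hs : (s.1 : ℕ) ≤ k := Nat.lt_succ_iff.1 s.1.2
    exact (contDiffAt_chartModel s.2 (fun j' hj' c' i => hpoly j' (lt_of_lt_of_le hj' hs) c' i) (hlog _ hs s.2)).of_le le_top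
  obtain ⟨C, hC, hbound⟩ := exists_sq_bound_on_compact_of_contDiffAt_two f hS hf
  refine ⟨C, ρ'', hC, hρ, fun U₀ hU₀ => (hrad (coeField U₀) hU₀).1 U₀ rfl, fun 𝔅 W U₀ hU₀ hU w => ?_⟩
  obtain ⟨hguard, -, -⟩ := hrad (coeField U₀) hU₀
  have hsb : SmallBelow (avOfRecord F N K) k U₀ := hguard U₀ rfl
  have hmem : coeField U₀ ∈ closedBall (1 : PBond (F.P K) 0 → Matrix (Fin N) (Fin N) ℂ) ρ'' := by
    rw [mem_closedBall, dist_eq_norm]; exact hU₀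
  have hfa : ContDiffAt ℝ 2 (f (coeField U₀)) 0 := by
    have h := hf _ hmem
    exact h.comp 0 (contDiffAt_const.prodMk contDiffAt_id)
  have hfa_d : ∀ᶠ X in 𝓝 (0 : PBond (F.P K) 0 → lieSU (Fin N)), DifferentiableAt ℝ (f (coeField U₀)) X :=
    (hfa.eventually (by simp)).mono fun X hX => hX.differentiableAt (by norm_num)
  have hfa_d2 : DifferentiableAt ℝ (fderiv ℝ (f (coeField U₀))) 0 :=
    ((hfa.fderiv_right (m := 1) (by norm_num)).differentiableAt (by norm_num))
  refine (pi_norm_le_iff_of_nonneg (by positivity)).2 fun i => ?_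
  set s : Σ j : Fin (k + 1), PBond (F.P K) j := ⟨((constrEnumB 𝔅 k).symm i).1, ((constrEnumB 𝔅 k).symm i).2.1⟩ with hs
  have h1 : fderiv ℝ (fderiv ℝ (msChartB F N K k 𝔅 W U₀)) 0 w w i = fderiv ℝ (fderiv ℝ (fun X => msChartB F N K k 𝔅 W U₀ X i)) 0 w w :=
    fderiv_fderiv_apply_pi (eventually_differentiableAt_msChartB hU hsb) (hasFDerivAt_fderiv_msChartB hU hsb).differentiableAt i w w
  have h2 : fderiv ℝ (fderiv ℝ (fun X => msChartB F N K k 𝔅 W U₀ X i)) 0 = fderiv ℝ (fderiv ℝ (fun X => f (coeField U₀) X s)) 0 :=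
    fderiv_fderiv_congr_of_eventuallyEq (eventually_msChartB_apply_eq_chartModel hU hsb i)
  have h3 : fderiv ℝ (fderiv ℝ (fun X => f (coeField U₀) X s)) 0 w w = fderiv ℝ (fderiv ℝ (f (coeField U₀))) 0 w w s :=
    (fderiv_fderiv_apply_pi hfa_d hfa_d2 s w w).symm
  rw [h1, h2, h3]
  exact (norm_le_pi_norm _ s).trans (hbound _ hmem w)

end UniformB

end Literature.MathematicalPhysics.QuantumFieldTheory.Balaban1983to89.Node00

end
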